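import Summits.CriticalPhenomena.CardyFormulaZ2.Theorems.CardySusyWardParafermionPrecompactFourClassTransferOfEdgePrecompact

/-!
# Line `four-class-vertex-transfer` — SKELETON v3 (lead c2, FINAL SHAPE) for the crux
`CardySusyWard.ParafermionPrecompact` (item stmt-CriticalPhenomena-11293, route `CardySusyWard`)

Lead `prover-line-stmt-CriticalPhenomena-11293-c2-0` (third lead on the crux), 2026-08-16.  This is lead c1's
skeleton v2 (`Lines/four_class_vertex_transfer.lean`, registered a964541d) reduced to its final shape now that the
by-name glue `repairedAt_of_edgePrecompact : EdgePrecompact → ∀ D Λ, C′(D, Λ)` has LANDED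
(`Theorems/CardySusyWardParafermionPrecompactFourClassTransferOfEdgePrecompact.lean`, on top of the route-free core
`repairedClauses_of_classBounds`, p113503, and `parafermionPrecompactRepairedAt_of_classBounds`, p115307):

* ONE registered stub, `stub_edgePrecompact : CardyComplexCone.EdgePrecompact` — the twin crux
  stmt-CriticalPhenomena-11387 BY NAME (led by `prover-line-stmt-CriticalPhenomena-11387-c2-0`, line
  `qkz-strip-boundary-arm`; no worker of THIS crux may take it);
* the composition `parafermionPrecompactRepairedAt_of` / `_proof` = `import` + `exact` (sorry only in the stub);
* the RESTATEMENT block for the tenure planner: `ParafermionPrecompactGuarded` = the rev-5 text VERBATIM with the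
  guard `z ∈ (zdGraph 2).edgeSet →` inserted in clause (i) and `z ∈ … → z' ∈ … →` in clause (ii) (the crux-plan
  planner's text, = the refuters' `Repaired.lean`), `guarded_iff_repairedAt` (it IS `∀ D Λ, C′(D, Λ)`, by currying),
  its closing term `parafermionPrecompactGuarded_of_edgePrecompact`, and the two certificates that motivate this
  seat's verdict — `typedCrux_iff_not_H` (the rev-5 decl is LITERALLY `¬ ParafermionBulkNondegenerate`, p74235) and
  `typedCrux_iff_guarded_and_not_H` (typed text = intended text ∧ the negation of the route's own conjecture).

Audit target (`ledger skeleton check … --crux-decl`): `Negative.ParafermionPrecompactRepairedAt`, as for every line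
of this crux — no honest file concludes the rev-5 decl.  Verdict of this seat: `verdict: misstated` — restate 11293 as
`ParafermionPrecompactGuarded` (keep the decl name so that `ParafermionFamiliesToSLESix` and `Assembly` follow by name);
the restated item then closes by `parafermionPrecompactGuarded_of_edgePrecompact` the moment 11387 closes.
-/

noncomputable section

namespace Summit.CriticalPhenomena.CardyFormulaZ2.Cruxes.ParafermionPrecompact.FourClassVertexTransfer

open _root_.Literature.Probability.LatticeModels
open _root_.Literature.Probability.RandomPlanarGeometry (DobrushinDomain)
open Summit.CriticalPhenomena.CardyFormulaZ2.Theorems.ParafermionPrecompact.Negative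
  (IsFamily ParafermionPrecompactRepairedAt repaired_of_parafermionPrecompact
    parafermionPrecompact_iff_not_bulkNondegenerate)
open Summit.CriticalPhenomena.CardyFormulaZ2.Theses.CardyComplexCone (EdgePrecompact)

/-! ### The registered stub and the composition -/

/-- **Registered stub — the transfer target C⁺ = the twin crux `CardyComplexCone.EdgePrecompact` BY NAME**
(stmt-CriticalPhenomena-11387; XL/open: per-class bound and same-class equicontinuity of `δ^{-1/3}`·(dart
observable) on compacts — tightness of the Duminil-Copin–Smirnov normalisation at `σ = 1/3`; it has its own crux
directory and lead and is discharged here by `exact` from the theorem that closes 11387).  Why it might fail: the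
sharp `1/3` itself (two-arm a-priori `δ^{1/4}`, missing `δ^{1/12}` winding-phase cancellation on `ℤ²`). [folklore] -/
theorem stub_edgePrecompact : EdgePrecompact := by
  sorry

/-- **The line's composition** (sorry-free glue, all of it landed): the single stub gives the repaired crux
`C′(D, Λ)` for every `D, Λ`, BY NAME. [folklore] -/
theorem parafermionPrecompactRepairedAt_of :
    EdgePrecompact →
      ∀ (D : DobrushinDomain) (Λ : ℝ → DiscreteDobrushin), ParafermionPrecompactRepairedAt D Λ :=
  repairedAt_of_edgePrecompact

/-- The skeleton in its final shape: the repaired crux from the registered stub (depends on `sorryAx` only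
through `stub_edgePrecompact`). [folklore] -/
theorem parafermionPrecompactRepairedAt_proof :
    ∀ (D : DobrushinDomain) (Λ : ℝ → DiscreteDobrushin), ParafermionPrecompactRepairedAt D Λ :=
  parafermionPrecompactRepairedAt_of stub_edgePrecompact

/-! ### The restatement text (for the tenure planner) and its relation to the typed decl -/

/-- **`C′` unfolded — the text to restate stmt-CriticalPhenomena-11293 with**: the rev-5 text VERBATIM with
`z ∈ (Literature.Probability.LatticeModels.zdGraph 2).edgeSet →` inserted after `∀ z : …MedialVertex,` in clause (i)
and `z ∈ (…zdGraph 2).edgeSet → z' ∈ (…zdGraph 2).edgeSet →` after `∀ z z' : …MedialVertex,` in clause (ii); nothing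
else changes (`IsCompact K`, `K ⊆ D.carrier` are certified load-bearing, Disproof.lean §8).  Fully qualified, so the
body can be pasted into the Theses file as is. [folklore] -/
def ParafermionPrecompactGuarded : Prop :=
  ∀ (D : Literature.Probability.RandomPlanarGeometry.DobrushinDomain) (Λ : ℝ → Literature.Probability.LatticeModels.DiscreteDobrushin), (∀ δ, (Λ δ).Ω = D.carrier) → (∀ δ, (Λ δ).δ = δ) → Filter.Tendsto (fun δ : ℝ => Metric.hausdorffEDist (Λ δ).arcA (D.arc 0)) (nhdsWithin (0:ℝ) (Set.Ioi 0)) (nhds 0) → Filter.Tendsto (fun δ : ℝ => Metric.hausdorffEDist (Λ δ).arcB (D.arc 1)) (nhdsWithin (0:ℝ) (Set.Ioi 0)) (nhds 0) → Filter.Tendsto (fun δ : ℝ => Metric.hausdorffEDist (Literature.Probability.LatticeModels.medialPoint δ '' (Λ δ).zdABEdges) {D.pt 0, D.pt 1}) (nhdsWithin (0:ℝ) (Set.Ioi 0)) (nhds 0) → (∀ᶠ δ in nhdsWithin (0:ℝ) (Set.Ioi 0), (Λ δ).IsZdAdmissible) → ∀ K : Set ℂ, IsCompact K → K ⊆ D.carrier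 → (∃ C : ℝ, ∀ᶠ δ in nhdsWithin (0:ℝ) (Set.Ioi 0), ∀ z : Literature.Probability.LatticeModels.MedialVertex, z ∈ (Literature.Probability.LatticeModels.zdGraph 2).edgeSet → Literature.Probability.LatticeModels.medialPoint δ z ∈ K → ‖(∫ ω, Literature.Probability.LatticeModels.passageSum (Literature.Probability.LatticeModels.medialExploration (Λ δ) ω) δ (1 / 3) z ∂(Literature.Probability.Percolation.bondPercolation (Literature.Probability.LatticeModels.zdGraph 2) Literature.Probability.Percolation.half))‖ ≤ C * δ ^ ((1:ℝ) / 3)) ∧ (∀ ε > (0:ℝ), ∃ η > (0:ℝ), ∀ᶠ δ in nhdsWithin (0:ℝ) (Set.Ioi 0), ∀ z z' : Literature.Probability.LatticeModels.MedialVertex, z ∈ (Literature.Probability.LatticeModels.zdGraph 2).edgeSet → z' ∈ (Literature.Probability.LatticeModels.zdGraph 2).edgeSet → Literature.Probability.LatticeModels.medialPoint δ z ∈ K → Literature.Probability.LatticeModels.medialPoint δ z' ∈ K → dist (Literature.Probability.LatticeModels.medialPoint δ z) (Literature.Probability.LatticeModels.medialPoint δ z') < η → ‖(∫ ω, Literature.Probability.LatticeModels.passageSum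 (Literature.Probability.LatticeModels.medialExploration (Λ δ) ω) δ (1 / 3) z ∂(Literature.Probability.Percolation.bondPercolation (Literature.Probability.LatticeModels.zdGraph 2) Literature.Probability.Percolation.half)) - (∫ ω, Literature.Probability.LatticeModels.passageSum (Literature.Probability.LatticeModels.medialExploration (Λ δ) ω) δ (1 / 3) z' ∂(Literature.Probability.Percolation.bondPercolation (Literature.Probability.LatticeModels.zdGraph 2) Literature.Probability.Percolation.half))‖ ≤ ε * δ ^ ((1:ℝ) / 3))

/-- The curried guarded text IS the disprover's `C′` for every domain and family (family hypotheses
bundled/unbundled; `Iff` by currying). [folklore] -/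
theorem guarded_iff_repairedAt :
    ParafermionPrecompactGuarded ↔
      ∀ (D : DobrushinDomain) (Λ : ℝ → DiscreteDobrushin), ParafermionPrecompactRepairedAt D Λ := by
  constructor
  · intro h D Λ hfam K hK hKD
    exact h D Λ hfam.1 hfam.2.1 hfam.2.2.1 hfam.2.2.2.1 hfam.2.2.2.2.1 hfam.2.2.2.2.2 K hK hKD
  · intro h D Λ h1 h2 h3 h4 h5 h6 K hK hKD
    exact h D Λ ⟨h1, h2, h3, h4, h5, h6⟩ K hK hKD

/-- **Closing term of the restated item**: `EdgePrecompact` (stmt-11387) ⇒ the guarded text — what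
`theorem ParafermionPrecompact_proof` becomes, by unfolding, once 11293 carries the guarded text. [folklore] -/
theorem parafermionPrecompactGuarded_of_edgePrecompact : EdgePrecompact → ParafermionPrecompactGuarded :=
  fun h => guarded_iff_repairedAt.2 (repairedAt_of_edgePrecompact h)

/-- The guarded text from the registered stub (the skeleton's conclusion in restated form). [folklore] -/
theorem parafermionPrecompactGuarded_proof : ParafermionPrecompactGuarded :=
  parafermionPrecompactGuarded_of_edgePrecompact stub_edgePrecompact

/-- **Why no file concludes the rev-5 decl**: AS TYPED the crux is the NEGATION of bulk non-degeneracy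
`H = Literature.Probability.LatticeModels.ParafermionBulkNondegenerate` (landed, p74235; re-exported). [folklore] -/
theorem typedCrux_iff_not_H :
    Theses.CardySusyWard.ParafermionPrecompact ↔ ¬ ParafermionBulkNondegenerate :=
  parafermionPrecompact_iff_not_bulkNondegenerate

/-- The guarded text is a weakening of the typed one: nothing provable is lost by the restatement. [folklore] -/
theorem guarded_of_typed (h : Theses.CardySusyWard.ParafermionPrecompact) : ParafermionPrecompactGuarded :=
  guarded_iff_repairedAt.2 (repaired_of_parafermionPrecompact h)

/-- **The misstatement in one line**: the rev-5 text is EXACTLY "the intended (guarded) text AND `¬H`" — i.e.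
the restated crux conjoined with the failure of the very conjecture (DCS 2012, Conj. 8.7 at `q = 1`) the route
sets out to prove.  Hence `verdict: misstated`, repair = drop the second conjunct = insert the edge guards.
[folklore] -/
theorem typedCrux_iff_guarded_and_not_H :
    Theses.CardySusyWard.ParafermionPrecompact ↔
      (ParafermionPrecompactGuarded ∧ ¬ ParafermionBulkNondegenerate) :=
  ⟨fun h => ⟨guarded_of_typed h, typedCrux_iff_not_H.1 h⟩, fun h => typedCrux_iff_not_H.2 h.2⟩

end Summit.CriticalPhenomena.CardyFormulaZ2.Cruxes.ParafermionPrecompact.FourClassVertexTransfer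

end
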